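import Mathlib.AlgebraicGeometry.Pullbacks
import Mathlib.CategoryTheory.Monoidal.Cartesian.Mon
import Literature.RingTheory.Derivation.ResidueJacobianOne
import HarnessLib

/-!
# The relative Jacobian of the group law at the unit section has residue `1` (PIN-2b, `E`-side)

Topic `Literature/AlgebraicGeometry/GroupSchemes`, namespace `Literature.AlgebraicGeometry.GroupSchemes`.  THEOREMS ONLY
(no definition, no named fact, no instance, no `sorry`; imports Mathlib + ★ `RingTheory/Derivation/ResidueJacobianOne`).
Cell `hodgecm-mathlib` (D-0151), road W toward `r₀`, (W0) «the group law of `A_K` is an `R`-birational group law on a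
smooth proper model» (B-p18's W0-CORE-SPEC §4, leaf L4c′ «the shear cocycle is a unit at the `K`-point `z = (ε, ε)`»,
pin PIN-2b).  The statement proved here is the geometric heart of «`Φ^*(pr₂^*θ) = pr₂^*θ` at the origin» in the
`ω`-argument ([EdixhovenRomagny] proof of Thm. 6.3; [BLRNeronModels1990] §4.3): in local coordinates `yⱼ` of `E` near
the unit `ε`, at the point `z = (ε, ε)` of `E × E` the Jacobian matrix of `(μ♯ yⱼ)ⱼ` against the basis `d(pr₂♯ yⱼ)` of
`Ω[𝒪_{E×E,z} ⁄ Γ(E, V)]` (scalars through `pr₁♯`) is `≡ 1 (mod 𝔪_z)`, so its determinant has residue `1`.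

The proof is the «`δ = δ_E`» argument made elementary: along the unit slice `i : x ↦ (ε, x)` one has `i ≫ pr₂ = 𝟙 = i ≫ μ`
and `i ≫ pr₁ = ` the constant map `ε`; on stalks this gives ring maps `p = pr₂♯`, `μ♯ : 𝒪_{E,ε} → 𝒪_{E×E,z}` with the
common retraction `s = i♯`, and `p ∘ s` sends the scalars `pr₁♯ a` to the constants `pr₁♯ (a(ε))`; the abstract
statement ★ `Literature.RingTheory.Derivation.residue_det_eq_one_of_section` then applies.

* §1 (any schemes) `base_apply_base_of_comp_eq_id`, **`stalkMap_stalkMap_stalkSpecializes_of_comp_eq_id`** (`i ≫ q = 𝟙`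
  ⇒ `i♯ ∘ q♯ = id` on `𝒪_{X,x}`, through the specialisation `q (i x) ⤳ x`), `germ_app_congr`,
  **`stalkMap_section_const`** (`p₂♯ i♯ p₁♯ (germ a) = p₁♯ (germ (c^* a)|_V)` when `i ≫ p₁ = c`, `p₂ ≫ c = p₁ ≫ c`).
* §2 (any schemes) **`residue_det_stalkMap_germ_eq_one`** — the group-free scheme form: `p₁ p₂ m : Y ⟶ X`, a common
  section `i` of `p₂` and `m` with `i ≫ p₁ = c` constant (`p₂ ≫ c = p₁ ≫ c`), `A := Γ(X, V)` acting on `𝒪_{Y, i x}` through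
  `p₁♯` ⇒ `residue (b.det (d(m♯ yⱼ))ⱼ) = 1` for any basis `b = (d(p₂♯ yⱼ))ⱼ` of `Ω[𝒪_{Y,i x}⁄A]`.
* §3 (monoid objects `E` of `Over (Spec K)`, `K` a field) `unitSection_left_comp_snd_left/mul_left/fst_left`,
  `snd_left_comp_const_eq_fst_left_comp_const`, `const_base_apply`, `le_preimage_const`, and
  **`residue_det_unitSection_eq_one`** — the `E`-side PIN-2b at `z = i ε`, `i = (lift (toUnit E ≫ η[E]) (𝟙 E)).left`,
  `ε = η[E] (closed point)`, in the currency of ★ `Motives.exists_basis_stalk_tensorObj_eq_D` (its output `b`, `hb` at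
  `q := z` are the inputs here).

HC_CM is proved only modulo the 7 printed citations until rung 0 closes; banked leaf (no floor change).

## References
* [EdixhovenRomagny] B. Edixhoven, M. Romagny, *Group schemes out of birational group laws, Néron models*,
  arXiv:1204.1799v2, §6, proof of Thm. 6.3 (the `ω`-argument).
* [BLRNeronModels1990] S. Bosch, W. Lütkebohmert, M. Raynaud, *Néron Models* (1990), §4.3 (numbers only; not held).
-/

noncomputable section

universe u

namespace Literature.AlgebraicGeometry.GroupSchemes

open CategoryTheory Limits _root_.AlgebraicGeometry MonoidalCategory CartesianMonoidalCategory
open scoped MonObj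

/-! ## §1 Stalks along a section: `i♯ ∘ q♯ = id` and the constants -/

section Section

variable {X Y : Scheme.{u}} (i : X ⟶ Y)

/-- If `i ≫ q = 𝟙` then `q (i x) = x`. [cite: EdixhovenRomagny, proof of Thm. 6.3] -/
theorem base_apply_base_of_comp_eq_id (q : Y ⟶ X) (hq : i ≫ q = 𝟙 X) (x : X) :
    q.base (i.base x) = x := by
  rw [← Scheme.Hom.comp_apply, hq]; rfl

/-- **Retraction on stalks.** If `i ≫ q = 𝟙 X` then, at `x`, `i♯_x ∘ q♯_{i x} ∘ (specialisation `𝒪_{X,x} → 𝒪_{X,q(i x)}`)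
is the identity of `𝒪_{X,x}`. [cite: EdixhovenRomagny, proof of Thm. 6.3] -/
theorem stalkMap_stalkMap_stalkSpecializes_of_comp_eq_id (q : Y ⟶ X) (hq : i ≫ q = 𝟙 X) (x : X)
    (h : q.base (i.base x) ⤳ x) (g : X.presheaf.stalk x) :
    i.stalkMap x (q.stalkMap (i.base x) (X.presheaf.stalkSpecializes h g)) = g := by
  have h1 : q.stalkMap (i.base x) ≫ i.stalkMap x = (i ≫ q).stalkMap x := (Scheme.Hom.stalkMap_comp i q x).symm
  have h2 := Scheme.Hom.stalkMap_congr_hom (i ≫ q) (𝟙 X) hq x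
  simp only [Scheme.Hom.stalkMap_id] at h2
  change (X.presheaf.stalkSpecializes h ≫ q.stalkMap (i.base x) ≫ i.stalkMap x) g = g
  rw [h1, h2, TopCat.Presheaf.stalkCongr_hom]
  erw [Category.comp_id, TopCat.Presheaf.stalkSpecializes_comp, TopCat.Presheaf.stalkSpecializes_refl]
  rfl

/-- Germs of `f^* a` and `g^* a` agree when `f = g` (transport of the membership proof).
[cite: EdixhovenRomagny, proof of Thm. 6.3] -/
theorem germ_app_congr {f g : X ⟶ Y} (e : f = g) (U : Y.Opens) (x : X) (hx : f.base x ∈ U) (a : Γ(Y, U)) :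
    X.presheaf.germ (f ⁻¹ᵁ U) x hx (f.app U a) = X.presheaf.germ (g ⁻¹ᵁ U) x (e ▸ hx) (g.app U a) := by
  subst e; rfl

/-- **Constants along a section.** Let `i : X ⟶ Y` with `i ≫ p₂ = 𝟙`, `i ≫ p₁ = c` («constant»), and
`p₂ ≫ c = p₁ ≫ c`; let `V` be an open of `X` with `V ≤ c ⁻¹ V` containing `p₁ (i x)`.  Then for a section `a`
on `V`, the germ `p₂♯ (i♯ (p₁♯ a))` at `i x` (read through the specialisation `p₂ (i x) ⤳ x`) is `p₁♯` of the
germ of the «constant» `(c^* a)|_V`.  (Geometry: `Y = E × E`, `c = ` the constant map `ε`, `p₁♯ Γ(E, V)` = the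
scalars `A`.) [cite: EdixhovenRomagny, proof of Thm. 6.3] -/
theorem stalkMap_section_const (p₁ p₂ : Y ⟶ X) (c : X ⟶ X) (h₁ : i ≫ p₁ = c) (h₂ : i ≫ p₂ = 𝟙 X)
    (hc : p₂ ≫ c = p₁ ≫ c) (x : X) (V : X.Opens) (hV : p₁.base (i.base x) ∈ V) (hle : V ≤ c ⁻¹ᵁ V)
    (h : p₂.base (i.base x) ⤳ x) (a : Γ(X, V)) :
    p₂.stalkMap (i.base x) (X.presheaf.stalkSpecializes h
      (i.stalkMap x (p₁.stalkMap (i.base x) (X.presheaf.germ V (p₁.base (i.base x)) hV a)))) =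
    p₁.stalkMap (i.base x) (X.presheaf.germ V (p₁.base (i.base x)) hV
      (X.presheaf.map (homOfLE hle).op (c.app V a))) := by
  have hxc : x ∈ (i ≫ p₁) ⁻¹ᵁ V := hV
  have hx₁ : x ∈ c ⁻¹ᵁ V := h₁ ▸ hxc
  -- the point `x` is `c (p₁ (i x))`-related: `c x ∈ V`, and `c (p₂ (i x)) = c x`
  have hpc : i.base x ∈ (p₂ ≫ c) ⁻¹ᵁ V := by
    change c.base (p₂.base (i.base x)) ∈ V
    rw [base_apply_base_of_comp_eq_id i p₂ h₂]
    exact hx₁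
  rw [Scheme.Hom.germ_stalkMap_apply, Scheme.Hom.germ_stalkMap_apply]
  -- `i^* p₁^* a = (i ≫ p₁)^* a = c^* a`
  have e1 : X.presheaf.germ (i ⁻¹ᵁ p₁ ⁻¹ᵁ V) x hV (i.app (p₁ ⁻¹ᵁ V) (p₁.app V a)) =
      X.presheaf.germ (c ⁻¹ᵁ V) x hx₁ (c.app V a) := by
    rw [← germ_app_congr h₁ V x hxc a, Scheme.Hom.comp_app]; rfl
  rw [e1, TopCat.Presheaf.germ_stalkSpecializes_apply, Scheme.Hom.germ_stalkMap_apply]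
  -- `p₂^* c^* a = (p₂ ≫ c)^* a = (p₁ ≫ c)^* a = p₁^* c^* a`
  have e2 : Y.presheaf.germ (p₂ ⁻¹ᵁ c ⁻¹ᵁ V) (i.base x) hpc (p₂.app (c ⁻¹ᵁ V) (c.app V a)) =
      Y.presheaf.germ ((p₁ ≫ c) ⁻¹ᵁ V) (i.base x) (hc ▸ hpc) ((p₁ ≫ c).app V a) := by
    rw [← germ_app_congr hc V (i.base x) hpc a, Scheme.Hom.comp_app]; rfl
  rw [e2, TopCat.Presheaf.germ_res_apply X.presheaf (homOfLE hle) _ hV, Scheme.Hom.germ_stalkMap_apply,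
    Scheme.Hom.comp_app]
  rfl

end Section

/-! ## §2 The relative Jacobian of `m` along a section has residue `1` (scheme form of PIN-2b) -/

section Jacobian

variable {X Y : Scheme.{u}} (i : X ⟶ Y) (p₁ p₂ m : Y ⟶ X) (c : X ⟶ X)

/-- **PIN-2b, scheme form (group-free).**  Let `p₁ p₂ m : Y ⟶ X` («projections» and «multiplication»),
`i : X ⟶ Y` a common section of `p₂` and `m` (`i ≫ p₂ = 𝟙 = i ≫ m`) with `i ≫ p₁ = c` «constant» in the sense
`p₂ ≫ c = p₁ ≫ c`, `x : X`, `z := i x`, and `V` an open of `X` through `p₁ z`, `p₂ z`, `m z` with `V ≤ c ⁻¹ V`.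
Let `A := Γ(X, V)` act on `𝒪_{Y,z}` through `p₁♯_z` (hypothesis `hA`, the convention of
★ `Motives.exists_basis_stalk_tensorObj_eq_D`).  If `d(p₂♯_z yⱼ)` (`yⱼ ∈ Γ(X, V)`) is a basis of `Ω[𝒪_{Y,z}⁄A]`, then
the determinant of `(d(m♯_z yⱼ))ⱼ` in this basis has residue `1`.  Proof: `residue_det_eq_one_of_section` with
`O' := 𝒪_{X,x}`, `p := p₂♯`, `μ := m♯`, `s := i♯` (`stalkMap_stalkMap_stalkSpecializes_of_comp_eq_id`,
`stalkMap_section_const`). [cite: EdixhovenRomagny, proof of Thm. 6.3; BLRNeronModels1990, §4.3] -/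
theorem residue_det_stalkMap_germ_eq_one (h₁ : i ≫ p₁ = c) (h₂ : i ≫ p₂ = 𝟙 X) (hm : i ≫ m = 𝟙 X)
    (hc : p₂ ≫ c = p₁ ≫ c) (x : X) (V : X.Opens) (hle : V ≤ c ⁻¹ᵁ V)
    (hz₁ : p₁.base (i.base x) ∈ V) (hz₂ : p₂.base (i.base x) ∈ V) (hzm : m.base (i.base x) ∈ V)
    [Algebra Γ(X, V) (Y.presheaf.stalk (i.base x))]
    (hA : algebraMap Γ(X, V) (Y.presheaf.stalk (i.base x)) =
      (p₁.stalkMap (i.base x)).hom.comp (X.presheaf.germ V (p₁.base (i.base x)) hz₁).hom)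
    {n : ℕ} (y : Fin n → Γ(X, V))
    (b : Module.Basis (Fin n) (Y.presheaf.stalk (i.base x)) Ω[(Y.presheaf.stalk (i.base x))⁄Γ(X, V)])
    (hb : ∀ j, b j = KaehlerDifferential.D Γ(X, V) _
      (p₂.stalkMap (i.base x) (X.presheaf.germ V (p₂.base (i.base x)) hz₂ (y j)))) :
    IsLocalRing.residue _ (b.det fun j => KaehlerDifferential.D Γ(X, V) _
      (m.stalkMap (i.base x) (X.presheaf.germ V (m.base (i.base x)) hzm (y j)))) = 1 := by
  -- specialisations `p₂ z ⤳ x`, `m z ⤳ x` (both points ARE `x`)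
  have hs₂ : p₂.base (i.base x) ⤳ x := (Inseparable.of_eq (base_apply_base_of_comp_eq_id i p₂ h₂ x)).specializes
  have hsm : m.base (i.base x) ⤳ x := (Inseparable.of_eq (base_apply_base_of_comp_eq_id i m hm x)).specializes
  have hxV : x ∈ V := base_apply_base_of_comp_eq_id i p₂ h₂ x ▸ hz₂
  -- the ring-level data
  let p : X.presheaf.stalk x →+* Y.presheaf.stalk (i.base x) :=
    (p₂.stalkMap (i.base x)).hom.comp (X.presheaf.stalkSpecializes hs₂).hom
  let mu : X.presheaf.stalk x →+* Y.presheaf.stalk (i.base x) :=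
    (m.stalkMap (i.base x)).hom.comp (X.presheaf.stalkSpecializes hsm).hom
  let s : Y.presheaf.stalk (i.base x) →+* X.presheaf.stalk x := (i.stalkMap x).hom
  have hsp : ∀ g, s (p g) = g := fun g => stalkMap_stalkMap_stalkSpecializes_of_comp_eq_id i p₂ h₂ x hs₂ g
  have hsμ : ∀ g, s (mu g) = g := fun g => stalkMap_stalkMap_stalkSpecializes_of_comp_eq_id i m hm x hsm g
  have hA' : ∀ a, KaehlerDifferential.D Γ(X, V) (Y.presheaf.stalk (i.base x))
      (p (s (algebraMap Γ(X, V) (Y.presheaf.stalk (i.base x)) a))) ∈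
      (IsLocalRing.maximalIdeal (Y.presheaf.stalk (i.base x))) •
        (⊤ : Submodule (Y.presheaf.stalk (i.base x)) Ω[(Y.presheaf.stalk (i.base x))⁄Γ(X, V)]) := by
    intro a
    have hconst : p (s (algebraMap Γ(X, V) (Y.presheaf.stalk (i.base x)) a)) =
        algebraMap Γ(X, V) (Y.presheaf.stalk (i.base x))
        (X.presheaf.map (homOfLE hle).op (c.app V a)) := by
      rw [hA, RingHom.comp_apply, RingHom.comp_apply]
      exact stalkMap_section_const i p₁ p₂ c h₁ h₂ hc x V hz₁ hle hs₂ a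
    rw [hconst, Derivation.map_algebraMap]
    exact zero_mem _
  -- the coordinates, as germs at `x`
  let zg : Fin n → X.presheaf.stalk x := fun j => X.presheaf.germ V x hxV (y j)
  have hpz : ∀ j, p (zg j) = p₂.stalkMap (i.base x) (X.presheaf.germ V (p₂.base (i.base x)) hz₂ (y j)) := fun j => by
    change p₂.stalkMap (i.base x) (X.presheaf.stalkSpecializes hs₂ (X.presheaf.germ V x hxV (y j))) = _
    rw [TopCat.Presheaf.germ_stalkSpecializes_apply]
  have hμz : ∀ j, mu (zg j) = m.stalkMap (i.base x) (X.presheaf.germ V (m.base (i.base x)) hzm (y j)) := fun j => by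
    change m.stalkMap (i.base x) (X.presheaf.stalkSpecializes hsm (X.presheaf.germ V x hxV (y j))) = _
    rw [TopCat.Presheaf.germ_stalkSpecializes_apply]
  have hb' : ∀ j, b j = KaehlerDifferential.D Γ(X, V) _ (p (zg j)) := fun j => by rw [hpz]; exact hb j
  have key := Literature.RingTheory.Derivation.residue_det_eq_one_of_section p mu s hsp hsμ hA' zg b hb'
  simp only [hμz] at key
  exact key

end Jacobian

/-! ## §3 Group objects over a field: the unit section `x ↦ (ε, x)` of `E ⊗ E` -/

section UnitSection

variable {K : Type u} [Field K] (E : Over (Spec (.of K))) [MonObj E]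

/-- The slice `i = (ε, id) : E → E ⊗ E` is a section of `pr₂`. [cite: EdixhovenRomagny, proof of Thm. 6.3] -/
theorem unitSection_left_comp_snd_left :
    (lift (toUnit E ≫ η[E]) (𝟙 E)).left ≫ (snd E E).left = 𝟙 E.left := by
  rw [← Over.comp_left, lift_snd, Over.id_left]

/-- The slice `i = (ε, id) : E → E ⊗ E` is a section of the multiplication (`ε · x = x`, the unit axiom).
[cite: EdixhovenRomagny, proof of Thm. 6.3] -/
theorem unitSection_left_comp_mul_left :
    (lift (toUnit E ≫ η[E]) (𝟙 E)).left ≫ μ[E].left = 𝟙 E.left := by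
  rw [← Over.comp_left, MonObj.lift_comp_one_left, Over.id_left]

/-- `pr₁ ∘ i` is the constant map `ε`. [cite: EdixhovenRomagny, proof of Thm. 6.3] -/
theorem unitSection_left_comp_fst_left :
    (lift (toUnit E ≫ η[E]) (𝟙 E)).left ≫ (fst E E).left = (toUnit E).left ≫ η[E].left := by
  rw [← Over.comp_left, lift_fst, Over.comp_left]

/-- The constant map `ε` equalises the two projections. [cite: EdixhovenRomagny, proof of Thm. 6.3] -/
theorem snd_left_comp_const_eq_fst_left_comp_const :
    (snd E E).left ≫ ((toUnit E).left ≫ η[E].left) = (fst E E).left ≫ ((toUnit E).left ≫ η[E].left) := by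
  have h : snd E E ≫ toUnit E ≫ η[E] = fst E E ≫ toUnit E ≫ η[E] := by
    rw [comp_toUnit_assoc, comp_toUnit_assoc]
  have h' := congrArg (fun f => f.left) h
  simp only [Over.comp_left] at h'
  exact h'

/-- The constant map `ε` sends every point to `ε`. [cite: EdixhovenRomagny, proof of Thm. 6.3] -/
theorem const_base_apply (x : E.left) :
    ((toUnit E).left ≫ η[E].left).base x = η[E].left.base (IsLocalRing.closedPoint K) := by
  haveI : Subsingleton ↥(𝟙_ (Over (Spec (CommRingCat.of K)))).left :=
    inferInstanceAs (Subsingleton ↥(Spec (CommRingCat.of K)))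
  rw [Scheme.Hom.comp_apply]
  exact congrArg η[E].left.base (Subsingleton.elim _ _)

/-- An open through `ε` is contained in its preimage under the constant map `ε` (which is everything).
[cite: EdixhovenRomagny, proof of Thm. 6.3] -/
theorem le_preimage_const {V : E.left.Opens} (hε : η[E].left.base (IsLocalRing.closedPoint K) ∈ V) :
    V ≤ ((toUnit E).left ≫ η[E].left) ⁻¹ᵁ V := fun v _ => by
  change ((toUnit E).left ≫ η[E].left).base v ∈ V
  rw [const_base_apply]
  exact hε

/-- **PIN-2b, `E`-side, for a group (monoid) object `E` over a field.**  At the point `z := i ε` of `E ⊗ E`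
(`i = (ε, id)` the unit slice, `ε` the unit point), with `V` an (affine) open through `pr₁ z`, `pr₂ z`, `μ z` and
`A := Γ(E, V)` acting on `𝒪_{E ⊗ E, z}` through `pr₁♯_z` (★ `Motives.exists_basis_stalk_tensorObj_eq_D` convention and
output `b`, `hb`): the determinant of `(d(μ♯_z yⱼ))ⱼ` in the basis `d(pr₂♯_z yⱼ)` of `Ω[𝒪_{E ⊗ E, z}⁄A]` has residue `1`
— «the relative Jacobian of `μ` at `(ε, ε)` is `≡ 1 (mod 𝔪)`», the heart of `Φ^*(pr₂^*θ) = pr₂^*θ` at the origin.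
[cite: EdixhovenRomagny, proof of Thm. 6.3; BLRNeronModels1990, §4.3] -/
theorem residue_det_unitSection_eq_one {V : E.left.Opens}
    (hz₁ : (fst E E).left.base ((lift (toUnit E ≫ η[E]) (𝟙 E)).left.base
      (η[E].left.base (IsLocalRing.closedPoint K))) ∈ V)
    (hz₂ : (snd E E).left.base ((lift (toUnit E ≫ η[E]) (𝟙 E)).left.base
      (η[E].left.base (IsLocalRing.closedPoint K))) ∈ V)
    (hzμ : μ[E].left.base ((lift (toUnit E ≫ η[E]) (𝟙 E)).left.base
      (η[E].left.base (IsLocalRing.closedPoint K))) ∈ V)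
    [Algebra Γ(E.left, V) ((E ⊗ E).left.presheaf.stalk ((lift (toUnit E ≫ η[E]) (𝟙 E)).left.base
      (η[E].left.base (IsLocalRing.closedPoint K))))]
    (hA : algebraMap Γ(E.left, V) ((E ⊗ E).left.presheaf.stalk ((lift (toUnit E ≫ η[E]) (𝟙 E)).left.base
      (η[E].left.base (IsLocalRing.closedPoint K)))) =
      ((fst E E).left.stalkMap _).hom.comp (E.left.presheaf.germ V _ hz₁).hom)
    {n : ℕ} (y : Fin n → Γ(E.left, V))
    (b : Module.Basis (Fin n) ((E ⊗ E).left.presheaf.stalk ((lift (toUnit E ≫ η[E]) (𝟙 E)).left.base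
      (η[E].left.base (IsLocalRing.closedPoint K))))
      Ω[((E ⊗ E).left.presheaf.stalk ((lift (toUnit E ≫ η[E]) (𝟙 E)).left.base
        (η[E].left.base (IsLocalRing.closedPoint K))))⁄Γ(E.left, V)])
    (hb : ∀ j, b j = KaehlerDifferential.D Γ(E.left, V) _
      ((snd E E).left.stalkMap _ (E.left.presheaf.germ V _ hz₂ (y j)))) :
    IsLocalRing.residue _ (b.det fun j => KaehlerDifferential.D Γ(E.left, V) _
      (μ[E].left.stalkMap _ (E.left.presheaf.germ V _ hzμ (y j)))) = 1 := by
  have hε : η[E].left.base (IsLocalRing.closedPoint K) ∈ V := by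
    have h := base_apply_base_of_comp_eq_id _ _ (unitSection_left_comp_snd_left E)
      (η[E].left.base (IsLocalRing.closedPoint K))
    rw [← h]
    exact hz₂
  exact residue_det_stalkMap_germ_eq_one (lift (toUnit E ≫ η[E]) (𝟙 E)).left (fst E E).left (snd E E).left
    μ[E].left ((toUnit E).left ≫ η[E].left) (unitSection_left_comp_fst_left E)
    (unitSection_left_comp_snd_left E) (unitSection_left_comp_mul_left E)
    (snd_left_comp_const_eq_fst_left_comp_const E) _ V (le_preimage_const E hε) hz₁ hz₂ hzμ hA y b hb

end UnitSection

end Literature.AlgebraicGeometry.GroupSchemes
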